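import Summits.Parity.GeneralizedHardyLittlewood.Theorems.LeeYangFibresRelativeDimOneTypeDataA
import Summits.Parity.GeneralizedHardyLittlewood.Theorems.LeeYangFibresRelativeDimOneTypeDataB
import HarnessLib

/-!
# Type data for the reshaped line `gallagher-backwards-split` (crux stmt-Parity-14113
`LeeYangFibres.RelativeDimOne`, stub `stub_typeData`), PART C: the spectrum side by residue counting

For a function `h` of the shift vector which is `M`-periodic, `M = P q₂` (`P` the cell modulus), the sum of `h`
over the shifts of the data box (sides `N + 1` points, corners `(2L+2)^{i+1} N`) lying in the type cell of the
target is, by block summation modulo `M` (`cell_sum_block`), `m^t` times the sum of `h` over the residue vectors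
`r ∈ [0, M)^t` of the cell, `m = ⌊(N+1)/M⌋`, up to `((m+1)^t − m^t)` times the same sum of `|h|`. When the residue
sums are evaluated (Chinese remainder theorem on type cells, PART D) as `K q₂^t A` and `K q₂^t A'`
(`K = #typeCell P P a b₀`, `A, A'` the conditional averages of `h, |h|` modulo `q`), this gives the normalised
estimates `|Σ_{cell ∩ box} h − K ((N+1)/P)^t A| ≤ 2 t K Q ((N+1)/P + Q)^{t−1} A'` (`cell_sum_modulus`,
registered hook `typeData_cellSum`), `Σ_{cell ∩ box} |h| ≤ K ((N+1)/P + Q)^t A'` (`cell_abs_sum_le`) for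
`q₂ ≤ Q`, and the count `#(cell ∩ box) ≤ K ((N+1)/P + 1)^t` (`cell_count_le`).
-/

noncomputable section

open scoped BigOperators Classical
open Finset Literature.NumberTheory.Sieve
open Summit.Parity.GeneralizedHardyLittlewood.Cruxes.RelativeDimOne.GallagherBackwardsSplit

namespace Summit.Parity.GeneralizedHardyLittlewood.Cruxes.RelativeDimOne.TypeSplit

namespace TypeDataProof

variable {t : ℕ}

/-! ### Elementary real inequalities -/

/-- `x^n − z^n ≤ n x^{n−1} (x − z)` for `0 ≤ z ≤ x`. -/
theorem pow_sub_pow_le {x z : ℝ} (hz : 0 ≤ z) (hzx : z ≤ x) :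
    ∀ n : ℕ, x ^ n - z ^ n ≤ n * x ^ (n - 1) * (x - z)
  | 0 => by simp
  | n + 1 => by
    have ih := pow_sub_pow_le hz hzx n
    have hx : 0 ≤ x := hz.trans hzx
    have hzn : z ^ n ≤ x ^ n := pow_le_pow_left₀ hz hzx n
    have key : x ^ (n + 1) - z ^ (n + 1) = x * (x ^ n - z ^ n) + z ^ n * (x - z) := by ring
    rw [key, Nat.add_sub_cancel]
    rcases n with _ | k
    · simp
    · rw [Nat.add_sub_cancel] at ih
      have h1 : x * (x ^ (k + 1) - z ^ (k + 1)) ≤ x * ((k + 1 : ℕ) * x ^ k * (x - z)) :=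
        mul_le_mul_of_nonneg_left ih hx
      have h2 : z ^ (k + 1) * (x - z) ≤ x ^ (k + 1) * (x - z) :=
        mul_le_mul_of_nonneg_right hzn (sub_nonneg.2 hzx)
      have h3 : x * (((k + 1 : ℕ) : ℝ) * x ^ k * (x - z)) = ((k + 1 : ℕ) : ℝ) * x ^ (k + 1) * (x - z) := by
        ring
      rw [h3] at h1
      push_cast at h1 ⊢
      linarith

/-! ### Periodicity -/

/-- An `M`-periodic function of integer shift vectors, read on `ℕ^t`, is `modVec M`-periodic. -/
theorem modVec_periodic {M : ℕ} (g : (Fin t → ℤ) → ℝ)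
    (hg : ∀ b b' : Fin t → ℤ, (∀ i, b i ≡ b' i [ZMOD M]) → g b = g b') (x : Fin t → ℕ) :
    g (fun i => ((Gallagher.modVec M x i : ℕ) : ℤ)) = g (fun i => (x i : ℤ)) :=
  hg _ _ fun i => by
    rw [Gallagher.modVec_apply, Int.natCast_mod]
    exact Int.mod_modEq _ _

/-- The restriction to the cell (modulus `P`) of an `M`-periodic function is `M`-periodic when `P ∣ M`. -/
theorem cellIndicator_periodic {P M : ℕ} (hPM : P ∣ M) (a b₀ : Fin t → ℤ) (φ : (Fin t → ℤ) → ℝ)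
    (hφ : ∀ b b' : Fin t → ℤ, (∀ i, b i ≡ b' i [ZMOD M]) → φ b = φ b') (b b' : Fin t → ℤ)
    (hbb' : ∀ i, b i ≡ b' i [ZMOD M]) :
    (if (∀ p ∈ P.primeFactors, incType p a b = incType p a b₀) then φ b else 0) =
      (if (∀ p ∈ P.primeFactors, incType p a b' = incType p a b₀) then φ b' else 0) := by
  have hc := isCell_congr a b₀ (fun i => (hbb' i).of_dvd (Int.natCast_dvd_natCast.2 hPM))
  rw [hφ b b' hbb']
  by_cases hcb : ∀ p ∈ P.primeFactors, incType p a b = incType p a b₀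
  · rw [if_pos hcb, if_pos (hc.1 hcb)]
  · rw [if_neg hcb, if_neg (fun h' => hcb (hc.2 h'))]

/-- The residue vectors of the cell in `[0, P)^t` are `typeCell P P a b₀`. -/
theorem filter_cell_eq_typeCell (P : ℕ) (a b₀ : Fin t → ℤ) :
    (Fintype.piFinset fun _ : Fin t => range P).filter
        (fun v => ∀ p ∈ P.primeFactors, incType p a (fun i => (v i : ℤ)) = incType p a b₀) =
      typeCell P P a b₀ := by
  ext v
  rw [mem_filter, mem_typeCell_self_iff]

/-! ### Block summation over the cell -/

/-- RESIDUE COUNTING, per modulus: for an `M`-periodic `h`, `P ∣ M`, and the data box with `N + 1` points a side,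
`m M ≤ N + 1 ≤ (m+1) M`: the sum of `h` over the shifts of the box in the cell is `m^t` times the sum of `h` over the
residue vectors `r ∈ [0,M)^t` of the cell, up to `((m+1)^t − m^t)` times the same sum of `|h|`. -/
theorem cell_sum_block {L N P M m : ℕ} (hM : 0 < M) (hPM : P ∣ M) (a b₀ : Fin t → ℤ)
    (h : (Fin t → ℤ) → ℝ) (hh : ∀ b b' : Fin t → ℤ, (∀ i, b i ≡ b' i [ZMOD M]) → h b = h b')
    (hlo : m * M ≤ N + 1) (hhi : N + 1 ≤ (m + 1) * M) :
    |∑ b ∈ (box (fun i => (((2 * L + 2) ^ (i.val + 1) * N : ℕ) : ℤ)) (fun _ => N)).filter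
          (fun b => ∀ p ∈ P.primeFactors, incType p a b = incType p a b₀), h b
        - (m : ℝ) ^ t * ∑ v ∈ (Fintype.piFinset fun _ : Fin t => range M).filter
            (fun v => ∀ p ∈ P.primeFactors, incType p a (fun i => (v i : ℤ)) = incType p a b₀),
            h (fun i => (v i : ℤ))|
      ≤ ((((m + 1 : ℕ)) : ℝ) ^ t - (m : ℝ) ^ t) *
          ∑ v ∈ (Fintype.piFinset fun _ : Fin t => range M).filter
            (fun v => ∀ p ∈ P.primeFactors, incType p a (fun i => (v i : ℤ)) = incType p a b₀),
            |h (fun i => (v i : ℤ))| := by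
  have hgper := cellIndicator_periodic hPM a b₀ h hh
  have hGper := modVec_periodic
    (fun b => if (∀ p ∈ P.primeFactors, incType p a b = incType p a b₀) then h b else 0) hgper
  have e1 : ∑ b ∈ (box (fun i => (((2 * L + 2) ^ (i.val + 1) * N : ℕ) : ℤ)) (fun _ => N)).filter
          (fun b => ∀ p ∈ P.primeFactors, incType p a b = incType p a b₀), h b =
      ∑ x ∈ Fintype.piFinset (fun i => Ico ((2 * L + 2) ^ (i.val + 1) * N)
          ((2 * L + 2) ^ (i.val + 1) * N + (N + 1))),
        (if (∀ p ∈ P.primeFactors, incType p a (fun i => ((x i : ℕ) : ℤ)) = incType p a b₀)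
          then h (fun i => ((x i : ℕ) : ℤ)) else 0) := by
    rw [Finset.sum_filter]
    exact sum_box_natCast (fun i => (2 * L + 2) ^ (i.val + 1) * N) (fun _ => N) _
  have e3 : ∑ v ∈ (Fintype.piFinset fun _ : Fin t => range M).filter
        (fun v => ∀ p ∈ P.primeFactors, incType p a (fun i => (v i : ℤ)) = incType p a b₀),
        h (fun i => (v i : ℤ)) =
      ∑ v ∈ (Fintype.piFinset fun _ : Fin t => range M),
        (if (∀ p ∈ P.primeFactors, incType p a (fun i => (v i : ℤ)) = incType p a b₀)
          then h (fun i => (v i : ℤ)) else 0) := by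
    rw [Finset.sum_filter]
  have e4 : ∑ v ∈ (Fintype.piFinset fun _ : Fin t => range M).filter
        (fun v => ∀ p ∈ P.primeFactors, incType p a (fun i => (v i : ℤ)) = incType p a b₀),
        |h (fun i => (v i : ℤ))| =
      ∑ v ∈ (Fintype.piFinset fun _ : Fin t => range M),
        |(if (∀ p ∈ P.primeFactors, incType p a (fun i => (v i : ℤ)) = incType p a b₀)
          then h (fun i => (v i : ℤ)) else 0)| := by
    rw [Finset.sum_filter]
    refine Finset.sum_congr rfl fun v _ => ?_
    split_ifs <;> simp
  rw [e1, e3, e4]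
  exact block_sum_remainder hM (fun i => (2 * L + 2) ^ (i.val + 1) * N) hlo hhi _ hGper

/-- The number of shifts of the data box in the cell is at most `#typeCell P P a b₀ · ((N+1)/P + 1)^t`. -/
theorem cell_count_le {L N P : ℕ} (hP : 0 < P) (a b₀ : Fin t → ℤ) :
    ((((box (fun i => (((2 * L + 2) ^ (i.val + 1) * N : ℕ) : ℤ)) (fun _ => N)).filter
          (fun b => ∀ p ∈ P.primeFactors, incType p a b = incType p a b₀)).card : ℕ) : ℝ)
      ≤ ((typeCell P P a b₀).card : ℝ) * ((((N + 1 : ℕ)) : ℝ) / P + 1) ^ t := by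
  set m := (N + 1) / P with hmdef
  have hhi : N + 1 ≤ (m + 1) * P := by
    rw [Nat.add_mul, one_mul]
    exact (Nat.lt_div_mul_add hP).le
  have hgper := cellIndicator_periodic (dvd_refl P) a b₀ (fun _ => (1 : ℝ)) (fun _ _ _ => rfl)
  have hGper := modVec_periodic
    (fun b => if (∀ p ∈ P.primeFactors, incType p a b = incType p a b₀) then (1 : ℝ) else 0) hgper
  have e1 : ((((box (fun i => (((2 * L + 2) ^ (i.val + 1) * N : ℕ) : ℤ)) (fun _ => N)).filter
          (fun b => ∀ p ∈ P.primeFactors, incType p a b = incType p a b₀)).card : ℕ) : ℝ) =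
      ∑ x ∈ Fintype.piFinset (fun i => Ico ((2 * L + 2) ^ (i.val + 1) * N)
          ((2 * L + 2) ^ (i.val + 1) * N + (N + 1))),
        (if (∀ p ∈ P.primeFactors, incType p a (fun i => ((x i : ℕ) : ℤ)) = incType p a b₀)
          then (1 : ℝ) else 0) := by
    rw [Finset.card_eq_sum_ones, Nat.cast_sum, Finset.sum_filter]
    push_cast
    have := sum_box_natCast (fun i => (2 * L + 2) ^ (i.val + 1) * N) (fun _ => N)
      (fun b => if (∀ p ∈ P.primeFactors, incType p a b = incType p a b₀) then (1 : ℝ) else 0)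
    simpa using this
  have e2 : ∑ v ∈ (Fintype.piFinset fun _ : Fin t => range P),
        (if (∀ p ∈ P.primeFactors, incType p a (fun i => (v i : ℤ)) = incType p a b₀)
          then (1 : ℝ) else 0) = ((typeCell P P a b₀).card : ℝ) := by
    rw [← Finset.sum_filter, filter_cell_eq_typeCell, Finset.sum_const, nsmul_eq_mul, mul_one]
  have hle := block_sum_le hP (fun i => (2 * L + 2) ^ (i.val + 1) * N) hhi
    (fun x => if (∀ p ∈ P.primeFactors, incType p a (fun i => ((x i : ℕ) : ℤ)) = incType p a b₀)
      then (1 : ℝ) else 0) hGper (fun x => by positivity)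
  rw [e2] at hle
  rw [e1]
  refine hle.trans ?_
  have hm : ((m : ℕ) : ℝ) ≤ (((N + 1 : ℕ)) : ℝ) / P := by
    rw [le_div_iff₀ (by exact_mod_cast hP)]
    exact_mod_cast Nat.div_mul_le_self (N + 1) P
  have h1 : (((m + 1 : ℕ)) : ℝ) ^ t ≤ ((((N + 1 : ℕ)) : ℝ) / P + 1) ^ t := by
    apply pow_le_pow_left₀ (by positivity)
    push_cast at hm ⊢
    linarith
  rw [mul_comm]
  exact mul_le_mul_of_nonneg_left h1 (by positivity)

/-! ### The normalised estimates for one modulus -/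

/-- SPECTRUM SIDE, one modulus: if the residue sums of `h` and `|h|` over the cell modulo `M = P q₂` are
`K q₂^t A` and `K q₂^t A'` (`|A| ≤ A'`, `q₂ ≤ Q`), then
`|Σ_{cell ∩ box} h − K ((N+1)/P)^t A| ≤ 2 t K Q ((N+1)/P + Q)^{t−1} A'`. -/
theorem cell_sum_modulus {L N P q₂ : ℕ} (hP : 0 < P) (hq₂ : 1 ≤ q₂) {Q : ℝ} (hq₂Q : (q₂ : ℝ) ≤ Q)
    (a b₀ : Fin t → ℤ) (h : (Fin t → ℤ) → ℝ)
    (hh : ∀ b b' : Fin t → ℤ, (∀ i, b i ≡ b' i [ZMOD (P * q₂ : ℕ)]) → h b = h b')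
    {K A A' : ℝ} (hK : 0 ≤ K) (hAA' : |A| ≤ A')
    (HA : ∑ v ∈ (Fintype.piFinset fun _ : Fin t => range (P * q₂)).filter
        (fun v => ∀ p ∈ P.primeFactors, incType p a (fun i => (v i : ℤ)) = incType p a b₀),
        h (fun i => (v i : ℤ)) = K * (q₂ : ℝ) ^ t * A)
    (HA' : ∑ v ∈ (Fintype.piFinset fun _ : Fin t => range (P * q₂)).filter
        (fun v => ∀ p ∈ P.primeFactors, incType p a (fun i => (v i : ℤ)) = incType p a b₀),
        |h (fun i => (v i : ℤ))| = K * (q₂ : ℝ) ^ t * A') :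
    |∑ b ∈ (box (fun i => (((2 * L + 2) ^ (i.val + 1) * N : ℕ) : ℤ)) (fun _ => N)).filter
          (fun b => ∀ p ∈ P.primeFactors, incType p a b = incType p a b₀), h b
        - K * ((((N + 1 : ℕ)) : ℝ) / P) ^ t * A|
      ≤ 2 * t * K * Q * ((((N + 1 : ℕ)) : ℝ) / P + Q) ^ (t - 1) * A' := by
  have hM : 0 < P * q₂ := Nat.mul_pos hP hq₂
  set m := (N + 1) / (P * q₂) with hmdef
  have hlo : m * (P * q₂) ≤ N + 1 := Nat.div_mul_le_self _ _
  have hhi : N + 1 ≤ (m + 1) * (P * q₂) := by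
    rw [Nat.add_mul, one_mul]
    exact (Nat.lt_div_mul_add hM).le
  have hblock := cell_sum_block (L := L) hM (Dvd.intro q₂ rfl) a b₀ h hh hlo hhi
  rw [HA, HA'] at hblock
  set S := ∑ b ∈ (box (fun i => (((2 * L + 2) ^ (i.val + 1) * N : ℕ) : ℤ)) (fun _ => N)).filter
          (fun b => ∀ p ∈ P.primeFactors, incType p a b = incType p a b₀), h b with hS
  set x : ℝ := (((N + 1 : ℕ)) : ℝ) / P with hx
  have hP' : (0 : ℝ) < P := by exact_mod_cast hP
  have hy1 : (1 : ℝ) ≤ q₂ := by exact_mod_cast hq₂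
  have hQ0 : (0 : ℝ) ≤ Q := by linarith
  have hz0 : (0 : ℝ) ≤ (m : ℝ) * q₂ := by positivity
  have hzx : (m : ℝ) * q₂ ≤ x := by
    rw [hx, le_div_iff₀ hP']
    have h1 : ((m * (P * q₂) : ℕ) : ℝ) ≤ ((N + 1 : ℕ) : ℝ) := by exact_mod_cast hlo
    push_cast at h1 ⊢
    nlinarith
  have hxzy : x ≤ (m : ℝ) * q₂ + q₂ := by
    rw [hx, div_le_iff₀ hP']
    have h1 : ((N + 1 : ℕ) : ℝ) ≤ (((m + 1) * (P * q₂) : ℕ) : ℝ) := by exact_mod_cast hhi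
    push_cast at h1 ⊢
    nlinarith
  have hx0 : 0 ≤ x := hz0.trans hzx
  have hA'0 : 0 ≤ A' := (abs_nonneg A).trans hAA'
  have e1 : (m : ℝ) ^ t * (K * (q₂ : ℝ) ^ t * A) = K * ((m : ℝ) * q₂) ^ t * A := by
    rw [mul_pow]; ring
  have e2 : ((((m + 1 : ℕ)) : ℝ) ^ t - (m : ℝ) ^ t) * (K * (q₂ : ℝ) ^ t * A') =
      K * (((m : ℝ) * q₂ + q₂) ^ t - ((m : ℝ) * q₂) ^ t) * A' := by
    have : ((m : ℝ) * q₂ + q₂) = (((m + 1 : ℕ)) : ℝ) * q₂ := by push_cast; ring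
    rw [this, mul_pow, mul_pow]; ring
  rw [e1, e2] at hblock
  -- the two power differences
  have h1 : ((m : ℝ) * q₂ + q₂) ^ t - ((m : ℝ) * q₂) ^ t ≤ t * (x + Q) ^ (t - 1) * q₂ := by
    have h := pow_sub_pow_le hz0 (by linarith : (m : ℝ) * q₂ ≤ (m : ℝ) * q₂ + q₂) t
    have h' : ((m : ℝ) * q₂ + q₂) ^ (t - 1) ≤ (x + Q) ^ (t - 1) :=
      pow_le_pow_left₀ (by positivity) (by linarith) _
    calc ((m : ℝ) * q₂ + q₂) ^ t - ((m : ℝ) * q₂) ^ t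
        ≤ t * ((m : ℝ) * q₂ + q₂) ^ (t - 1) * ((m : ℝ) * q₂ + q₂ - (m : ℝ) * q₂) := h
      _ = t * ((m : ℝ) * q₂ + q₂) ^ (t - 1) * q₂ := by ring
      _ ≤ t * (x + Q) ^ (t - 1) * q₂ := by gcongr
  have h2 : x ^ t - ((m : ℝ) * q₂) ^ t ≤ t * (x + Q) ^ (t - 1) * q₂ := by
    have h := pow_sub_pow_le hz0 hzx t
    have h' : x ^ (t - 1) ≤ (x + Q) ^ (t - 1) := pow_le_pow_left₀ hx0 (by linarith) _
    calc x ^ t - ((m : ℝ) * q₂) ^ t ≤ t * x ^ (t - 1) * (x - (m : ℝ) * q₂) := h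
      _ ≤ t * x ^ (t - 1) * q₂ := by
          apply mul_le_mul_of_nonneg_left (by linarith) (by positivity)
      _ ≤ t * (x + Q) ^ (t - 1) * q₂ := by gcongr
  have hzt : ((m : ℝ) * q₂) ^ t ≤ x ^ t := pow_le_pow_left₀ hz0 hzx t
  calc |S - K * x ^ t * A|
      ≤ |S - K * ((m : ℝ) * q₂) ^ t * A| + |K * ((m : ℝ) * q₂) ^ t * A - K * x ^ t * A| :=
        abs_sub_le _ _ _
    _ ≤ K * (((m : ℝ) * q₂ + q₂) ^ t - ((m : ℝ) * q₂) ^ t) * A' + K * (x ^ t - ((m : ℝ) * q₂) ^ t) * A' := by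
        refine add_le_add hblock ?_
        rw [show K * ((m : ℝ) * q₂) ^ t * A - K * x ^ t * A = -((K * (x ^ t - ((m : ℝ) * q₂) ^ t)) * A) by ring,
          abs_neg, abs_mul, abs_of_nonneg (mul_nonneg hK (sub_nonneg.2 hzt))]
        exact mul_le_mul_of_nonneg_left hAA' (mul_nonneg hK (sub_nonneg.2 hzt))
    _ ≤ K * (t * (x + Q) ^ (t - 1) * q₂) * A' + K * (t * (x + Q) ^ (t - 1) * q₂) * A' := by
        gcongr
    _ = 2 * t * K * q₂ * (x + Q) ^ (t - 1) * A' := by ring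
    _ ≤ 2 * t * K * Q * (x + Q) ^ (t - 1) * A' := by gcongr

/-- SPECTRUM SIDE, one modulus, absolute values: `Σ_{cell ∩ box} |h| ≤ K ((N+1)/P + Q)^t A'`. -/
theorem cell_abs_sum_le {L N P q₂ : ℕ} (hP : 0 < P) (hq₂ : 1 ≤ q₂) {Q : ℝ} (hq₂Q : (q₂ : ℝ) ≤ Q)
    (a b₀ : Fin t → ℤ) (h : (Fin t → ℤ) → ℝ)
    (hh : ∀ b b' : Fin t → ℤ, (∀ i, b i ≡ b' i [ZMOD (P * q₂ : ℕ)]) → h b = h b')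
    {K A' : ℝ} (hK : 0 ≤ K) (hA'0 : 0 ≤ A')
    (HA' : ∑ v ∈ (Fintype.piFinset fun _ : Fin t => range (P * q₂)).filter
        (fun v => ∀ p ∈ P.primeFactors, incType p a (fun i => (v i : ℤ)) = incType p a b₀),
        |h (fun i => (v i : ℤ))| = K * (q₂ : ℝ) ^ t * A') :
    ∑ b ∈ (box (fun i => (((2 * L + 2) ^ (i.val + 1) * N : ℕ) : ℤ)) (fun _ => N)).filter
          (fun b => ∀ p ∈ P.primeFactors, incType p a b = incType p a b₀), |h b|
      ≤ K * ((((N + 1 : ℕ)) : ℝ) / P + Q) ^ t * A' := by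
  have hM : 0 < P * q₂ := Nat.mul_pos hP hq₂
  set m := (N + 1) / (P * q₂) with hmdef
  have hhi : N + 1 ≤ (m + 1) * (P * q₂) := by
    rw [Nat.add_mul, one_mul]
    exact (Nat.lt_div_mul_add hM).le
  have hhabs : ∀ b b' : Fin t → ℤ, (∀ i, b i ≡ b' i [ZMOD (P * q₂ : ℕ)]) → |h b| = |h b'| :=
    fun b b' hbb' => by rw [hh b b' hbb']
  have hgper := cellIndicator_periodic (Dvd.intro q₂ rfl) a b₀ (fun b => |h b|) hhabs
  have hGper := modVec_periodic
    (fun b => if (∀ p ∈ P.primeFactors, incType p a b = incType p a b₀) then |h b| else 0) hgper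
  have e1 : ∑ b ∈ (box (fun i => (((2 * L + 2) ^ (i.val + 1) * N : ℕ) : ℤ)) (fun _ => N)).filter
          (fun b => ∀ p ∈ P.primeFactors, incType p a b = incType p a b₀), |h b| =
      ∑ x ∈ Fintype.piFinset (fun i => Ico ((2 * L + 2) ^ (i.val + 1) * N)
          ((2 * L + 2) ^ (i.val + 1) * N + (N + 1))),
        (if (∀ p ∈ P.primeFactors, incType p a (fun i => ((x i : ℕ) : ℤ)) = incType p a b₀)
          then |h (fun i => ((x i : ℕ) : ℤ))| else 0) := by
    rw [Finset.sum_filter]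
    exact sum_box_natCast (fun i => (2 * L + 2) ^ (i.val + 1) * N) (fun _ => N) _
  have e2 : ∑ v ∈ (Fintype.piFinset fun _ : Fin t => range (P * q₂)),
        (if (∀ p ∈ P.primeFactors, incType p a (fun i => (v i : ℤ)) = incType p a b₀)
          then |h (fun i => (v i : ℤ))| else 0) = K * (q₂ : ℝ) ^ t * A' := by
    rw [← Finset.sum_filter, HA']
  have hle := block_sum_le hM (fun i => (2 * L + 2) ^ (i.val + 1) * N) hhi
    (fun x => if (∀ p ∈ P.primeFactors, incType p a (fun i => ((x i : ℕ) : ℤ)) = incType p a b₀)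
      then |h (fun i => ((x i : ℕ) : ℤ))| else 0) hGper (fun x => by positivity)
  rw [e2] at hle
  rw [e1]
  refine hle.trans ?_
  have hP' : (0 : ℝ) < P := by exact_mod_cast hP
  have hxzy : (((m + 1 : ℕ)) : ℝ) * q₂ ≤ (((N + 1 : ℕ)) : ℝ) / P + Q := by
    have hlo : m * (P * q₂) ≤ N + 1 := Nat.div_mul_le_self _ _
    have h1 : ((m * (P * q₂) : ℕ) : ℝ) ≤ ((N + 1 : ℕ) : ℝ) := by exact_mod_cast hlo
    have h2 : (m : ℝ) * q₂ ≤ (((N + 1 : ℕ)) : ℝ) / P := by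
      rw [le_div_iff₀ hP']
      push_cast at h1 ⊢
      nlinarith
    push_cast at h2 ⊢
    nlinarith
  calc ((((m + 1 : ℕ)) : ℝ)) ^ t * (K * (q₂ : ℝ) ^ t * A')
      = K * ((((m + 1 : ℕ)) : ℝ) * q₂) ^ t * A' := by rw [mul_pow]; ring
    _ ≤ K * ((((N + 1 : ℕ)) : ℝ) / P + Q) ^ t * A' := by
        gcongr

/-- Registered hook (aux for `stub_typeData`): the spectrum side for one modulus. -/
theorem typeData_cellSum : ∀ {t L N P q₂ : ℕ}, 0 < P → 1 ≤ q₂ → ∀ {Q : ℝ}, (q₂ : ℝ) ≤ Q → ∀ (a b₀ : Fin t → ℤ) (h : (Fin t → ℤ) → ℝ), (∀ b b' : Fin t → ℤ, (∀ i, b i ≡ b' i [ZMOD (P * q₂ : ℕ)]) → h b = h b') → ∀ {K A A' : ℝ}, 0 ≤ K → |A| ≤ A' → ∑ v ∈ (Fintype.piFinset fun _ : Fin t => Finset.range (P * q₂)).filter (fun v => ∀ p ∈ P.primeFactors, incType p a (fun i => (v i : ℤ)) = incType p a b₀), h (fun i => (v i : ℤ)) = K * (q₂ : ℝ) ^ t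 * A → ∑ v ∈ (Fintype.piFinset fun _ : Fin t => Finset.range (P * q₂)).filter (fun v => ∀ p ∈ P.primeFactors, incType p a (fun i => (v i : ℤ)) = incType p a b₀), |h (fun i => (v i : ℤ))| = K * (q₂ : ℝ) ^ t * A' → |∑ b ∈ (box (fun i => (((2 * L + 2) ^ (i.val + 1) * N : ℕ) : ℤ)) (fun _ => N)).filter (fun b => ∀ p ∈ P.primeFactors, incType p a b = incType p a b₀), h b - K * ((((N + 1 : ℕ)) : ℝ) / P) ^ t * A| ≤ 2 * t * K * Q * ((((N + 1 : ℕ)) : ℝ) / P + Q) ^ (t - 1) * A' :=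
  fun hP hq₂ _ hq₂Q a b₀ h hh _ _ _ hK hAA' HA HA' => cell_sum_modulus hP hq₂ hq₂Q a b₀ h hh hK hAA' HA HA'

end TypeDataProof

end Summit.Parity.GeneralizedHardyLittlewood.Cruxes.RelativeDimOne.TypeSplit

end
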